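import Mathlib
import Summits.Ventures.FusionMHD.Models.CerfonFreidbergIterLikeQ25Data
import Summits.Ventures.FusionMHD.Models.CerfonFreidbergIterLikeQHalf
import Summits.Ventures.FusionMHD.Models.FluxSurfacePolarRayLoop
import HarnessLib

/-!
# Ventures/FusionMHD — Models/CerfonFreidbergIterLikeQ25.lean: ★ THE CERTIFIED SAFETY FACTOR `q(ψ_N = 1/4)/F` OF THE Cerfon–Freidberg
# ITER-like INSTANCE — `2.148000327 ≤ q/F ≤ 2.148000798` (polar `(6.35)` form), assembled from 32 kernel-checked panels
# (`ψ_N = 1/4` SIBLING of ★ #117 `Models/CerfonFreidbergIterLikeQHalf.lean`: a certified q-PROFILE SAMPLE on the CF rung)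

HONEST FRAMING (LADDER-GRIDFUSION three columns; CF rung; F2 item R2 «q on an interior surface of a shaped, NON-POLYNOMIAL equilibrium»,
`pub/gridfusion/models/F2-SCOPING.md` v1.5 §9(d): other surfaces).  With the certified axis value `q₀/F` (#34, `Models/CerfonFreidbergIterLikeAxis.lean`)
and ★ #117's `q(1/2)/F ∈ [2.40763819, 2.40763845]`, the siblings give a CERTIFIED MONOTONE SAMPLE of the q-profile of THE ITER-like model flux:
`q(0) < q(1/4) < q(1/2) < q(9/10)` (each `/F`, `F > 0` the free toroidal-field constant).
* CERTIFIED (kernel, this file + its imports; axioms standard): for THE flux of record `U = cfSolution 0 coeff` of the CF ITER-like instance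
  (`Models/CerfonFreidbergIterLikeAxisCert`), on the level `u₀ = 3U(X_a,0)/4` (`ψ_N = 1/4`, `ψ_N := 1 − U/U(X_a,0)`): along EVERY polar ray from the
  magnetic axis `(X_a, 0)` with angle `θ ∈ [0, π]` the flux first reaches the level at a unique radius `ρ(θ) ∈ (0.14, 0.26)` (model-7's glued `rayRadius`,
  continuous in `θ`, inside a tube of radius `< 2·10⁻⁸` around the kernel's Newton-in-the-program approximant), the radial derivative there is
  positive (`≥ 0.05`), and THE POLAR `(6.35)` INTEGRAL satisfies **`2·totLo ≤ ∫₀^{2π} ρ(θ)/((X_a + ρ(θ) cos θ)·D_r(θ, ρ(θ))) dθ ≤ 2·totHi`**, hence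
  **`2.148000327 ≤ qHalfOverF ≤ 2.148000798`** where `qHalfOverF := (1/2π)·∫₀^{2π} …` (the name is kept from the sibling file; here it denotes
  `q(1/4)/F`) is Freidberg's `q/F` of that surface in the polar form of `Models/FluxSurfacePolarRay.lean` (#88).  The lower half of the loop is
  the mirror image (`CFIterLike.U_neg`; the `ψ_N = 1/2` file's `rayProfile_neg` / `Dfield_neg` / `Dfield_periodic` BY NAME).  Width `4.7e-07`.
* VALIDATED (never used in a proof): model-5 g4 lineage-1 `bench/F2-CF-ITER-truth-lineage1.json` B3 (`q/F` at `ψ_N = 1/4`) and the float replay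
  of this file's stack machine (`2.1480005624`), inside the kernel bracket.
* MODELLED: analytic Cerfon–Freidberg family (ideal MHD, Solov'ev profiles `A = 0`, fixed analytic boundary), ITER-like triple
  `(8/25, 17/10, 33/100)`; `q` of a MODEL flux surface — nothing about a device, a discharge, or stability.
PIPELINE (all in the tree; `ψ_N = 1/4` siblings of the ★ #117 chain, everything level-independent reused BY NAME): `…Q25Defs` (programs) →
`…Q25Panels*` (32 Taylor-model panel certificates, `decide +kernel`) → `…Q25Sound` → `…Q25Boxes/A/B` (interval boxes) → `…Q25Link/Panel`
→ `…Q25Data` (32 brackets) → here: the panel sum (`PolarRay.sum_panel_bounds`), the mirror symmetry, the headline.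
Typer/prover: gridfusion-model-5 (g8), 2026-08-27.  Citations: Freidberg 2014 §6.3.5 (6.35), §6.6.1 (6.153) [Freidberg2014];
Pataki–Cerfon–Freidberg 2013 §6.1 [PatakiCerfonFreidberg2013]; Mahboubi–Melquiond–Sibut-Pinote 2016 [MahboubiMelquiondSibutpinote2016].
-/

noncomputable section

open Set MeasureTheory intervalIntegral
open Literature.Analysis.ValidatedNumerics Literature.Analysis.ValidatedNumerics.PolyMP
open Literature.MathematicalPhysics.MHD Literature.MathematicalPhysics.MHD.CerfonFreidberg
open Summit.Ventures.FusionMHD.Models.PolarRay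

set_option autoImplicit false

namespace Summit.Ventures.FusionMHD.Models.CFIterLike.Q25

/-! ## §3 The sum over `[0, π]` (`ψ_N = 1/4`) -/

/-- `aθ 0 = 0`, `aθ 32 = π`. -/
theorem aθ_ends : CFIterLike.Q25.aθ 0 = 0 ∧ aθ 32 = Real.pi := by
  constructor <;> norm_num [aθ, panelLeft, CFIterLike.QHalf.hw]

/-- The certified lower sum `Σ Lo_j` (`ψ_N = 1/4`). -/
def totLo : ℚ := (674814204799701 / 100000000000000)
/-- The certified upper sum `Σ Hi_j` (`ψ_N = 1/4`). -/
def totHi : ℚ := (337407176266353 / 50000000000000)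

/-- The sums of the `ψ_N = 1/4` link bounds are `totLo`, `totHi`. -/
theorem sums_eq : (∑ k ∈ Finset.range 32, (((CFIterLike.Q25.lP k).Lo : ℚ) : ℝ)) = ((totLo : ℚ) : ℝ)
    ∧ (∑ k ∈ Finset.range 32, (((lP k).Hi : ℚ) : ℝ)) = ((totHi : ℚ) : ℝ) := by
  constructor
  · rw [show (∑ k ∈ Finset.range 32, (((lP k).Lo : ℚ) : ℝ)) = ((∑ k ∈ Finset.range 32, (lP k).Lo : ℚ) : ℝ) by push_cast; rfl]
    exact_mod_cast (by decide +kernel : (∑ k ∈ Finset.range 32, (lP k).Lo) = totLo)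
  · rw [show (∑ k ∈ Finset.range 32, (((lP k).Hi : ℚ) : ℝ)) = ((∑ k ∈ Finset.range 32, (lP k).Hi : ℚ) : ℝ) by push_cast; rfl]
    exact_mod_cast (by decide +kernel : (∑ k ∈ Finset.range 32, (lP k).Hi) = totHi)

/-- **THE UPPER HALF (`ψ_N = 1/4`)**: `totLo ≤ ∫₀^π Pq ≤ totHi`, and `Pq` is integrable on `[0, π]`. -/
theorem half_bounds : ((CFIterLike.Q25.totLo : ℚ) : ℝ) ≤ ∫ θ in (0 : ℝ)..Real.pi, Pq θ ∧ ∫ θ in (0 : ℝ)..Real.pi, Pq θ ≤ ((totHi : ℚ) : ℝ)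
    ∧ IntervalIntegrable Pq volume 0 Real.pi := by
  have hint : ∀ k < 32, IntervalIntegrable Pq volume (aθ k) (aθ (k + 1)) := by
    intro k hk
    interval_cases k
    · exact pb0.2.2
    · exact pb1.2.2
    · exact pb2.2.2
    · exact pb3.2.2
    · exact pb4.2.2
    · exact pb5.2.2
    · exact pb6.2.2
    · exact pb7.2.2
    · exact pb8.2.2
    · exact pb9.2.2
    · exact pb10.2.2
    · exact pb11.2.2
    · exact pb12.2.2
    · exact pb13.2.2
    · exact pb14.2.2
    · exact pb15.2.2
    · exact pb16.2.2
    · exact pb17.2.2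
    · exact pb18.2.2
    · exact pb19.2.2
    · exact pb20.2.2
    · exact pb21.2.2
    · exact pb22.2.2
    · exact pb23.2.2
    · exact pb24.2.2
    · exact pb25.2.2
    · exact pb26.2.2
    · exact pb27.2.2
    · exact pb28.2.2
    · exact pb29.2.2
    · exact pb30.2.2
    · exact pb31.2.2
  have hlo : ∀ k < 32, (((lP k).Lo : ℚ) : ℝ) ≤ ∫ θ in aθ k..aθ (k + 1), Pq θ := by
    intro k hk
    interval_cases k
    · exact pb0.1
    · exact pb1.1
    · exact pb2.1
    · exact pb3.1
    · exact pb4.1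
    · exact pb5.1
    · exact pb6.1
    · exact pb7.1
    · exact pb8.1
    · exact pb9.1
    · exact pb10.1
    · exact pb11.1
    · exact pb12.1
    · exact pb13.1
    · exact pb14.1
    · exact pb15.1
    · exact pb16.1
    · exact pb17.1
    · exact pb18.1
    · exact pb19.1
    · exact pb20.1
    · exact pb21.1
    · exact pb22.1
    · exact pb23.1
    · exact pb24.1
    · exact pb25.1
    · exact pb26.1
    · exact pb27.1
    · exact pb28.1
    · exact pb29.1
    · exact pb30.1
    · exact pb31.1
  have hhi : ∀ k < 32, ∫ θ in aθ k..aθ (k + 1), Pq θ ≤ (((lP k).Hi : ℚ) : ℝ) := by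
    intro k hk
    interval_cases k
    · exact pb0.2.1
    · exact pb1.2.1
    · exact pb2.2.1
    · exact pb3.2.1
    · exact pb4.2.1
    · exact pb5.2.1
    · exact pb6.2.1
    · exact pb7.2.1
    · exact pb8.2.1
    · exact pb9.2.1
    · exact pb10.2.1
    · exact pb11.2.1
    · exact pb12.2.1
    · exact pb13.2.1
    · exact pb14.2.1
    · exact pb15.2.1
    · exact pb16.2.1
    · exact pb17.2.1
    · exact pb18.2.1
    · exact pb19.2.1
    · exact pb20.2.1
    · exact pb21.2.1
    · exact pb22.2.1
    · exact pb23.2.1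
    · exact pb24.2.1
    · exact pb25.2.1
    · exact pb26.2.1
    · exact pb27.2.1
    · exact pb28.2.1
    · exact pb29.2.1
    · exact pb30.2.1
    · exact pb31.2.1
  have hs := sum_panel_bounds (N := 32) (t := aθ) (f := Pq) hint hlo hhi
  rw [sums_eq.1, sums_eq.2, aθ_ends.1, aθ_ends.2] at hs
  have hI := IntervalIntegrable.trans_iterate (a := aθ) (n := 32) hint
  rw [aθ_ends.1, aθ_ends.2] at hI
  exact ⟨hs.1, hs.2, hI⟩

/-! ## §4 The mirror symmetry `θ ↦ −θ` and the lower half (`ψ_N = 1/4`) -/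

/-- The `ψ_N = 1/4` glued ray radius is even in `θ`. -/
theorem ρ_neg (θ : ℝ) : CFIterLike.Q25.ρ (-θ) = ρ θ := by
  unfold ρ rayRadius rootSet
  simp_rw [CFIterLike.QHalf.rayProfile_neg]

/-- The `ψ_N = 1/4` polar integrand is even in `θ`. -/
theorem Pq_neg (θ : ℝ) : CFIterLike.Q25.Pq (-θ) = Pq θ := by
  unfold Pq polarIntegrand
  rw [show rayRadius U Xa 0 u₀ (-θ) = ρ (-θ) from rfl, ρ_neg, CFIterLike.QHalf.Dfield_neg, Real.cos_neg]
  rfl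

/-- The `ψ_N = 1/4` polar integrand is `2π`-periodic. -/
theorem Pq_periodic (θ : ℝ) : CFIterLike.Q25.Pq (θ + 2 * Real.pi) = Pq θ := by
  unfold Pq polarIntegrand
  rw [show rayRadius U Xa 0 u₀ (θ + 2 * Real.pi) = rayRadius U Xa 0 u₀ θ from periodic_rayRadius U Xa 0 u₀ θ, CFIterLike.QHalf.Dfield_periodic,
    Real.cos_add_two_pi]

/-- **THE LOWER HALF IS THE MIRROR IMAGE (`ψ_N = 1/4`)**: `∫_π^{2π} Pq = ∫_0^π Pq`, with integrability. -/
theorem lower_half : ∫ θ in Real.pi..(2 * Real.pi), CFIterLike.Q25.Pq θ = ∫ θ in (0 : ℝ)..Real.pi, Pq θ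
    ∧ IntervalIntegrable Pq volume Real.pi (2 * Real.pi) := by
  have hrefl : ∀ x : ℝ, Pq (2 * Real.pi - x) = Pq x := by
    intro x; rw [show 2 * Real.pi - x = -x + 2 * Real.pi by ring, Pq_periodic, Pq_neg]
  constructor
  · have h := intervalIntegral.integral_comp_sub_left Pq (2 * Real.pi) (a := 0) (b := Real.pi)
    simp only [sub_zero, show 2 * Real.pi - Real.pi = Real.pi by ring] at h
    rw [← h]
    exact intervalIntegral.integral_congr fun x _ => hrefl x
  · have h := (half_bounds.2.2).comp_sub_left (2 * Real.pi)
    simp only [sub_zero, show 2 * Real.pi - Real.pi = Real.pi by ring] at h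
    have hfun : (fun x => Pq (2 * Real.pi - x)) = Pq := funext hrefl
    rw [hfun] at h
    exact h.symm

/-! ## §5 ★ The certified `ψ_N = 1/4` `q(ψ_N = 1/2)/F` -/

/-- **Freidberg's `q/F` of the surface `ψ_N = 1/4` in the polar `(6.35)` form** (name kept from the sibling file): `(1/2π)·∫₀^{2π} ρ/((X_a + ρ cos θ)·D_r(θ, ρ)) dθ`. -/
def qHalfOverF : ℝ := 1 / (2 * Real.pi) * ∫ θ in (0 : ℝ)..(2 * Real.pi), Pq θ

/-- **THE FULL-LOOP BRACKET (`ψ_N = 1/4`)**: `2·totLo ≤ ∫₀^{2π} Pq ≤ 2·totHi`. -/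
theorem full_bounds : 2 * ((CFIterLike.Q25.totLo : ℚ) : ℝ) ≤ ∫ θ in (0 : ℝ)..(2 * Real.pi), Pq θ
    ∧ ∫ θ in (0 : ℝ)..(2 * Real.pi), Pq θ ≤ 2 * ((totHi : ℚ) : ℝ) := by
  obtain ⟨h1, h2, hI⟩ := half_bounds
  obtain ⟨h3, hI2⟩ := lower_half
  rw [← intervalIntegral.integral_add_adjacent_intervals hI hI2, h3]
  constructor <;> linarith

/-- **★ THE HEADLINE: `2.148000327 ≤ q(ψ_N = 1/4)/F ≤ 2.148000798`** for THE Cerfon–Freidberg ITER-like MODEL flux at `ψ_N = 1/4` (polar `(6.35)`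
form; float 2.1480005624; the width `4.7e-07` is the tube envelope + the kernel's Taylor-model integral enclosure + `π`'s 20-digit box). -/
theorem qHalfOverF_bounds : ((2148000327 / 1000000000) : ℝ) ≤ CFIterLike.Q25.qHalfOverF ∧ qHalfOverF ≤ ((1074000399 / 500000000) : ℝ) := by
  obtain ⟨h1, h2⟩ := full_bounds
  have hpi1 := Real.pi_gt_d20; have hpi2 := Real.pi_lt_d20
  have hpi : 0 < Real.pi := Real.pi_pos
  norm_num [totLo, totHi] at h1 h2
  have e : qHalfOverF = (∫ θ in (0 : ℝ)..(2 * Real.pi), Pq θ) / (2 * Real.pi) := by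
    unfold qHalfOverF; rw [one_div, inv_mul_eq_div]
  rw [e]
  constructor
  · rw [le_div_iff₀ (by positivity)]; nlinarith [h1, hpi2]
  · rw [div_le_iff₀ (by positivity)]; nlinarith [h2, hpi1]

end Summit.Ventures.FusionMHD.Models.CFIterLike.Q25

end
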